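import Literature.NumberTheory.DiophantineGeometry.SuperellipticHeightsTFamily
import Literature.NumberTheory.DiophantineGeometry.RationalFunctionHeight
import Literature.NumberTheory.DiophantineGeometry.GenEllProjLine
import Literature.NumberTheory.DiophantineGeometry.GenEllImagePoints
import Literature.NumberTheory.DiophantineGeometry.GenEllDePoint
import HarnessLib

/-!
# The height input `hZht` of the noncritical-Belyi mechanism for the family `t_c` on `r^e = x(1-x)`

[GenEll] = S. Mochizuki, *Arithmetic elliptic curves in general position*, Math. J. Okayama Univ. 52
(2010), Prop. 1.4 (i), (iii) and the proof of Thm. 2.1 pp. 12–13; abc-iut cell, route item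
`Summit.ABC.ABC.Theses.IUTThetaPilot.GenEllTwo`, S6's plan GENELLTWO-P1ROUTE v2 §3 (b)/§4 (ruling #6:
`φ = ρ_T ∘ t_c` with `ρ_T = β_T ∘ ψ_T` a Belyi map of `ℙ¹` given by a coprime pair `(p₁, p₂)` over
`ℚ` and `t_c = 1/r + c·r^{k+1}/s`, `c = q ∈ ℚ^×`), package W4a-c. The mechanism bookkeeping
`GenEll.vojtaIneq_of_belyi_mechanism(_of_subset)` (p414036/p415485) consumes

  `hZht : A·ht(P) ≤ ht(Z P) + c₁`,  `A = deg ρ_T · (e+3)/e`,  `Z P = ρ_T(t_c(Q P))`,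

i.e. the LOWER height bound for the auxiliary point. This file delivers it as the composite of the
`ℙ¹` height machine for `ρ_T` (`exists_mul_logHeight₁_le_add_finrank`, p413290, Silverman VIII.5.6)
with the lower half of the two-sided comparison `e·h(t_c) = (e+3)·h(x) + O([L:ℚ])`
(`Superelliptic.exists_abs_logHeight₁_tFunC_sub_le_of_rat`, p416284):

* `exists_belyi_tFunC_height_lower` — raw form over a number field `L`:
  `n·(2k+4)·h_L(x) ≤ (2k+1)·h_L(p₁(t)/p₂(t)) + [L:ℚ]·c₁` for `s = 1 − 2x`, `r^{2k+1} = x(1−x)`,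
  `x ∉ {0,1}`, `s ≠ 0`, `t·(r·s) = s + q·r^{k+2}` (`n = max deg pᵢ`);
* `exists_belyi_tFunC_ht_lower` — the same in `NFPoint.ht`-currency for the two points `(L, x)` and
  `(L, p₁(t)/p₂(t))` presented over the common field `L`:
  `(n(2k+4)/(2k+1))·ht(L, x) ≤ ht(L, ρ(t)) + c₁'` (W9 moves to its own presentations by the
  presentation-invariance of `ht`, `GenEllProjLineInvariance` / `ht_dePoint`).

Everything is proved; no definitions, no named facts; classical height theory — nothing here refers to
the disputed parts of the abc-iut corpus.
-/

noncomputable section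

open Height Polynomial

namespace Literature.NumberTheory.DiophantineGeometry

namespace Superelliptic

/-- From `t·(r·s) = s + c·r^{k+2}` with `r ≠ 0`, `s ≠ 0`: `t = 1/r + c·r^{k+1}/s`. [folklore] -/
private theorem t_eq_of_mul_eq' {L : Type*} [Field L] {k : ℕ} {c r s t : L} (hr0 : r ≠ 0)
    (hs0 : s ≠ 0) (ht : t * (r * s) = s + c * r ^ (k + 2)) : t = r⁻¹ + c * (r ^ (k + 1) / s) := by
  rw [eq_div_of_mul_eq (mul_ne_zero hr0 hs0) ht]
  field_simp
  ring

/-- **`hZht`, raw form.** For `e = 2k+1` (`k ≥ 1`), `c = q ∈ ℚ^×` and a coprime pair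
`p₁, p₂ ∈ ℚ[X]` with `max deg = n`, there is `c₁` (depending only on `k, q, p₁, p₂`) such that for every
number field `L` and `x, r, s, t ∈ L` with `s = 1 − 2x`, `r^{2k+1} = x(1−x)`, `x ∉ {0,1}`, `s ≠ 0`,
`t·(r·s) = s + q·r^{k+2}`:
`n·(2k+4)·h_L(x) ≤ (2k+1)·h_L(p₁(t)/p₂(t)) + [L:ℚ]·c₁` — the height of `Z = ρ(t_c)` dominates
`deg ρ·(e+3)/e` times the height of `x` ([GenEll] Prop. 1.4 (i), (iii): `deg(ρ∘t_c) = deg ρ·(e+3)`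
against `deg x = e` on `D_e`). [cite: MochizukiGenEll2010, Prop 1.4 (i) p.6] -/
theorem exists_belyi_tFunC_height_lower (k : ℕ) (hk : 1 ≤ k) (q : ℚ) (hq : q ≠ 0) {p₁ p₂ : ℚ[X]}
    (hcop : IsCoprime p₁ p₂) {n : ℕ} (hp₁ : p₁.natDegree ≤ n) (hp₂ : p₂.natDegree ≤ n)
    (hn : p₁.natDegree = n ∨ p₂.natDegree = n) :
    ∃ c₁ : ℝ, ∀ (L : Type) [Field L] [NumberField L] (x r s t : L),
      s = 1 - 2 * x → r ^ (2 * k + 1) = x * (1 - x) → x ≠ 0 → x ≠ 1 → s ≠ 0 →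
      t * (r * s) = s + (q : L) * r ^ (k + 2) →
      (n : ℝ) * (2 * k + 4) * logHeight₁ x ≤
        (2 * k + 1 : ℝ) * logHeight₁ (aeval t p₁ / aeval t p₂) + Module.finrank ℚ L * c₁ := by
  obtain ⟨C₁, hC₁⟩ := exists_mul_logHeight₁_le_add_finrank hcop hp₁ hp₂ hn
  obtain ⟨C₂, hC₂⟩ := exists_abs_logHeight₁_tFunC_sub_le_of_rat (e := 2 * k + 1) (m' := k + 1)
    (by omega) (by omega) q hq
  refine ⟨(2 * k + 1) * C₁ + n * C₂, fun L _ _ x r s t hs hr hx0 hx1 hs0 ht => ?_⟩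
  have hr0 : r ≠ 0 := by
    intro h
    rw [h, zero_pow (by omega)] at hr
    exact mul_ne_zero hx0 (sub_ne_zero.mpr (Ne.symm hx1)) hr.symm
  have hs0' : (1 : L) - 2 * x ≠ 0 := hs ▸ hs0
  -- the `ℙ¹` machine for `ρ = p₁/p₂` at `t`
  have h1 := (hC₁ L t).1
  -- the lower half of `|(2k+1)·h(t_c) − (2k+4)·h(x)| ≤ C₂·[L:ℚ]`
  have h2 := (abs_le.mp (hC₂ L x r hr hx0 hx1 hs0')).1
  rw [← hs, ← t_eq_of_mul_eq' hr0 hs0 ht] at h2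
  push_cast at h2
  have hkR : (0 : ℝ) ≤ 2 * k + 1 := by positivity
  have hnR : (0 : ℝ) ≤ n := Nat.cast_nonneg _
  have hm1 := mul_le_mul_of_nonneg_left h1 hkR
  have hm2 := mul_le_mul_of_nonneg_left h2 hnR
  linarith

/-- **`hZht` in `ht`-currency over a common field.** Same data; for the points `(L, x)` and
`(L, p₁(t)/p₂(t))` presented over `L`:
`(n·(2k+4)/(2k+1))·ht(L, x) ≤ ht(L, p₁(t)/p₂(t)) + c₁/(2k+1)` — the hypothesis `hZht` of
`GenEll.vojtaIneq_of_belyi_mechanism` with `A = n(2k+4)/(2k+1) = deg ρ·(e+3)/e`, up to W9's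
re-presentation of both points over their minimal fields (`ht` is presentation-invariant).
[cite: MochizukiGenEll2010, Prop 1.4 (i) p.6] -/
theorem exists_belyi_tFunC_ht_lower (k : ℕ) (hk : 1 ≤ k) (q : ℚ) (hq : q ≠ 0) {p₁ p₂ : ℚ[X]}
    (hcop : IsCoprime p₁ p₂) {n : ℕ} (hp₁ : p₁.natDegree ≤ n) (hp₂ : p₂.natDegree ≤ n)
    (hn : p₁.natDegree = n ∨ p₂.natDegree = n) :
    ∃ c₁ : ℝ, ∀ (L : Type) [Field L] [NumberField L] (x r s t : L),
      s = 1 - 2 * x → r ^ (2 * k + 1) = x * (1 - x) → x ≠ 0 → x ≠ 1 → s ≠ 0 →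
      t * (r * s) = s + (q : L) * r ^ (k + 2) →
      ((n : ℝ) * (2 * k + 4) / (2 * k + 1)) * (GenEll.NFPoint.mk L x).ht ≤
        (GenEll.NFPoint.mk L (aeval t p₁ / aeval t p₂)).ht + c₁ / (2 * k + 1) := by
  obtain ⟨c₁, hc₁⟩ := exists_belyi_tFunC_height_lower k hk q hq hcop hp₁ hp₂ hn
  refine ⟨c₁, fun L _ _ x r s t hs hr hx0 hx1 hs0 ht => ?_⟩
  have h := hc₁ L x r s t hs hr hx0 hx1 hs0 ht
  simp only [GenEll.NFPoint.ht, GenEll.NFPoint.degree]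
  set D : ℝ := (Module.finrank ℚ L : ℝ) with hD
  have hDpos : 0 < D := by rw [hD]; exact_mod_cast Module.finrank_pos
  have hk0 : (0 : ℝ) < 2 * k + 1 := by positivity
  rw [div_mul_eq_mul_div, div_le_iff₀ hk0, add_mul, div_mul_cancel₀ _ hk0.ne']
  -- goal: n(2k+4)·(D⁻¹ h x) ≤ D⁻¹ h(ρ t)·(2k+1) + c₁
  have key : (n : ℝ) * (2 * k + 4) * (D⁻¹ * logHeight₁ x) ≤
      D⁻¹ * logHeight₁ (aeval t p₁ / aeval t p₂) * (2 * k + 1) + c₁ := by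
    have h' := mul_le_mul_of_nonneg_left h (inv_nonneg.mpr hDpos.le)
    have e1 : D⁻¹ * ((n : ℝ) * (2 * k + 4) * logHeight₁ x) =
        (n : ℝ) * (2 * k + 4) * (D⁻¹ * logHeight₁ x) := by ring
    have e2 : D⁻¹ * ((2 * k + 1 : ℝ) * logHeight₁ (aeval t p₁ / aeval t p₂) + D * c₁) =
        D⁻¹ * logHeight₁ (aeval t p₁ / aeval t p₂) * (2 * k + 1) + c₁ := by
      field_simp
    rw [e1, e2] at h'
    exact h'
  exact key


/-! ### The same in the W9 assembly's currency (`imageAt`, `dePoint`) — appended -/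

/-- **`hZht` for a presented point `Q` and its re-presented image.** Same data as
`exists_belyi_tFunC_ht_lower`, for an arbitrary presented point `Q = (L, x)` (`GenEll.NFPoint`) and
`r, s, t ∈ L`: `(n(2k+4)/(2k+1))·ht(Q) ≤ ht(Q.imageAt (p₁(t)/p₂(t))) + c₁/(2k+1)`, where
`Q.imageAt z = (ℚ(z), z)` is the image point RE-PRESENTED over its minimal field (w4-d032's
`GenEll.NFPoint.imageAt`, `ht_imageAt`) — literally the `hZht` binder of
`GenEll.vojtaIneq_of_belyi_mechanism(_of_subset)` with `Z P := (Q P).imageAt (ρ_T (t_c))`,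
`A = deg ρ_T·(e+3)/e`. [cite: MochizukiGenEll2010, Prop 1.4 (i) p.6] -/
theorem exists_belyi_tFunC_hZht (k : ℕ) (hk : 1 ≤ k) (q : ℚ) (hq : q ≠ 0) {p₁ p₂ : ℚ[X]}
    (hcop : IsCoprime p₁ p₂) {n : ℕ} (hp₁ : p₁.natDegree ≤ n) (hp₂ : p₂.natDegree ≤ n)
    (hn : p₁.natDegree = n ∨ p₂.natDegree = n) :
    ∃ c₁ : ℝ, ∀ (Q : GenEll.NFPoint) (r s t : Q.F),
      s = 1 - 2 * Q.x → r ^ (2 * k + 1) = Q.x * (1 - Q.x) → Q.x ≠ 0 → Q.x ≠ 1 → s ≠ 0 →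
      t * (r * s) = s + (q : Q.F) * r ^ (k + 2) →
      ((n : ℝ) * (2 * k + 4) / (2 * k + 1)) * Q.ht ≤
        (Q.imageAt (aeval t p₁ / aeval t p₂)).ht + c₁ / (2 * k + 1) := by
  obtain ⟨c₁, hc₁⟩ := exists_belyi_tFunC_ht_lower k hk q hq hcop hp₁ hp₂ hn
  refine ⟨c₁, fun Q r s t hs hr hx0 hx1 hs0 ht => ?_⟩
  have h := hc₁ Q.F Q.x r s t hs hr hx0 hx1 hs0 ht
  rw [GenEll.NFPoint.ht_imageAt]
  exact h

/-- **`hZht` for the `D_e`-point over `P`.** For a presented point `P = (F, x)` of `U`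
(`x ∉ {0, 1}`), its `D_e`-point `Q := P.dePoint (2k+1) = (F(r), x)` (w5-d015's `GenEll.NFPoint.dePoint`,
`r = P.deRoot (2k+1)`, `r^{2k+1} = x(1−x)`) and `s, t ∈ F(r)` with `s = 1 − 2x ≠ 0`,
`t·(r·s) = s + q·r^{k+2}`: `(n(2k+4)/(2k+1))·ht(P) ≤ ht(Q.imageAt (p₁(t)/p₂(t))) + c₁/(2k+1)`
(`ht(Q) = ht(P)`, `ht_dePoint`). [cite: MochizukiGenEll2010, Prop 1.4 (i) p.6] -/
theorem exists_belyi_tFunC_hZht_dePoint (k : ℕ) (hk : 1 ≤ k) (q : ℚ) (hq : q ≠ 0) {p₁ p₂ : ℚ[X]}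
    (hcop : IsCoprime p₁ p₂) {n : ℕ} (hp₁ : p₁.natDegree ≤ n) (hp₂ : p₂.natDegree ≤ n)
    (hn : p₁.natDegree = n ∨ p₂.natDegree = n) :
    ∃ c₁ : ℝ, ∀ (P : GenEll.NFPoint) (s t : (P.dePoint (2 * k + 1)).F), P.InU →
      s = 1 - 2 * (P.dePoint (2 * k + 1)).x → s ≠ 0 →
      t * (P.deRoot (2 * k + 1) * s) = s + (q : (P.dePoint (2 * k + 1)).F) * P.deRoot (2 * k + 1) ^ (k + 2) →
      ((n : ℝ) * (2 * k + 4) / (2 * k + 1)) * P.ht ≤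
        ((P.dePoint (2 * k + 1)).imageAt (aeval t p₁ / aeval t p₂)).ht + c₁ / (2 * k + 1) := by
  obtain ⟨c₁, hc₁⟩ := exists_belyi_tFunC_hZht k hk q hq hcop hp₁ hp₂ hn
  refine ⟨c₁, fun P s t hP hs hs0 ht => ?_⟩
  have hQU : (P.dePoint (2 * k + 1)).InU := (GenEll.NFPoint.inU_dePoint_iff P (2 * k + 1)).mpr hP
  have hr : P.deRoot (2 * k + 1) ^ (2 * k + 1) =
      (P.dePoint (2 * k + 1)).x * (1 - (P.dePoint (2 * k + 1)).x) := by
    rw [GenEll.NFPoint.deRoot_pow P (2 * k + 1) (by omega), GenEll.NFPoint.dePoint_x, map_mul, map_sub,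
      map_one]
  rw [← GenEll.NFPoint.ht_dePoint P (2 * k + 1)]
  exact hc₁ (P.dePoint (2 * k + 1)) (P.deRoot (2 * k + 1)) s t hs hr hQU.1 hQU.2 hs0 ht

end Superelliptic

end Literature.NumberTheory.DiophantineGeometry

end
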